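import Summits.PneNP.PneNP.Theorems.ChebyshevTracialDesignClassForcing
import Summits.PneNP.PneNP.Theorems.ChebyshevTracialDesignDictionaryRemainder
import Summits.PneNP.PneNP.Theorems.ChebyshevTracialDesignGeneralPositionKL
import Summits.PneNP.PneNP.Theorems.ChebyshevTracialDesignProfileExtrapolationHalf
import Summits.PneNP.PneNP.Theorems.ChebyshevTracialDesignRectangleDecayAll
import Summits.PneNP.PneNP.Theorems.ChebyshevTracialDesignReducedSpreadCell
import Summits.PneNP.PneNP.Theorems.ChebyshevTracialDesignSpectralNonTightness
import Summits.PneNP.PneNP.Theorems.ChebyshevTracialDesignSpectralNonTightnessLayers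
import Summits.PneNP.PneNP.Theorems.ChebyshevTracialDesignSpectralNonTightnessWide
import Summits.PneNP.PneNP.Theorems.ChebyshevTracialDesignTightMass
import Summits.PneNP.PneNP.Theorems.ChebyshevTracialDesignVirtualNonnegSpread
import Summits.PneNP.PneNP.Theorems.ChebyshevTracialDesignWeightedSNT
import Literature.Combinatorics.Additive.LevelDInequalitySn
import HarnessLib

/-!
# Cell pnp-psdrank, route `ChebyshevTracialDesign`: THE REMAINING KL-CONDITIONAL BRICKS ARE UNCONDITIONAL (census completion)
# (crux `TracialDecayExp20`, stmt-PneNP-19878)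

Brick 81b (prover g14). Companion of `…UnconditionalRungs` (brick 81, the 14 headline theorems): the other `(hKL : GlobalLevelDInequality)`
binders of the cell's `ChebyshevTracialDesign*` files — SNT in its three currencies (`snt_holds`, `snt_oddSet_holds`, `snt_wide_holds`), the tight-pair
COUNTS (`tight_card_ge_wide_holds`, `tight_card_ge_sym_oddSet_holds`), the sub-weight SNT, the all-rectangle decay in explicit parameters
(`rectangleDecayAll_holds`), the spread-cell value bounds and virtual nonnegativity of spread cells (`spreadCell_value_le_holds`,
`spreadCell_value_le_half_holds`, `reduced_spreadCell_value_le_holds`, `virtual_nonneg_spread_holds`, `head_layerBound_holds`), the even-layer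
correlation bound (`abs_layerCorr_even_le_holds`), the dictionary-remainder, general-position and class-forcing theorems — all fed
`Literature.Combinatorics.Additive.KeevashLifshitz.GlobalLevelDInequality_holds` (lit g23, p577118). After this file every KL-conditional statement of the
cell has an axiom-free twin in the tree (axioms ⊆ {propext, Classical.choice, Quot.sound}); statements unchanged.
[cite: KeevashLifshitz2023, Thm. 1.8] [cite: KellerLifshitzMarcus2023, Thm. 5.4] [cite: Rothvoss2017, §2 and Lemma 7 (PDF pp. 6–8)] [cite: KupavskiiZakharov2022, Lemma 11]
Stature: support/instrument (bookkeeping: hypothesis discharge only). WHAT THIS IS NOT: not the crux, nothing on psd rank of P_PM(K_n), no P-vs-NP content.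
-/

set_option linter.dupNamespace false -- `Summit.PneNP.PneNP.…`: summit = sub-problem (D-0017)

noncomputable section

namespace Summit.PneNP.PneNP.Theorems.ChebyshevTracialDesignUnconditionalRungs

open scoped Classical
open Finset Matrix Polynomial Literature.Barriers.PneNP Literature.Combinatorics.Optimization Literature.Computability.Complexity
open Literature.Combinatorics.SetFamily
open Literature.Combinatorics.SimpleGraph.CycleSpace
open Literature.Combinatorics.AssociationSchemes Literature.Combinatorics.AssociationSchemes.JohnsonHarmonics
open Literature.Combinatorics.AssociationSchemes.JohnsonSpectrum
open Literature.Combinatorics.AssociationSchemes.SliceLevelInequality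
open Literature.Combinatorics.AssociationSchemes.CutMatchingRestriction
open Literature.Combinatorics.AssociationSchemes.HomogeneousMatchingFamilies
open Literature.Combinatorics.Additive.KeevashLifshitz
open Summit.PneNP.PneNP.Theorems.ChebyshevTracialDesignLevelNormalisation
open Summit.PneNP.PneNP.Theorems.ChebyshevTracialDesignLevelTail
open Summit.PneNP.PneNP.Theorems.ChebyshevTracialDesignLevelWeightCompl
open Summit.PneNP.PneNP.Theorems.ChebyshevTracialDesignProfileExtrapolation
open Summit.PneNP.PneNP.Theorems.ChebyshevTracialDesignProfileExtrapolationHalf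
open Summit.PneNP.PneNP.Theorems.ChebyshevTracialDesignProfilePolynomial
open Summit.PneNP.PneNP.Theorems.ChebyshevTracialDesignReducedSpreadCell
open Summit.PneNP.PneNP.Theorems.ChebyshevTracialDesignRungAssemblyAll
open Summit.PneNP.PneNP.Theorems.ChebyshevTracialDesignRungConstants
open Summit.PneNP.PneNP.Theorems.ChebyshevTracialDesignSpectralNonTightness
open Summit.PneNP.PneNP.Theorems.ChebyshevTracialDesignSpectralNonTightnessEstimates
open Summit.PneNP.PneNP.Theorems.ChebyshevTracialDesignSpectralNonTightnessLayers
open Summit.PneNP.PneNP.Theorems.ChebyshevTracialDesignSpectralNonTightnessWide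
open Summit.PneNP.PneNP.Theorems.ChebyshevTracialDesignSquareSlackDesign
open Summit.PneNP.PneNP.Theorems.ChebyshevTracialDesignTightColumnSums
open Summit.PneNP.PneNP.Theorems.ChebyshevTracialDesignTightEigenDecay
open Summit.PneNP.PneNP.Theorems.ChebyshevTracialDesignTightEvenProduct
open Summit.PneNP.PneNP.Theorems.ChebyshevTracialDesignTightFreeLayers
open Summit.PneNP.PneNP.Theorems.ChebyshevTracialDesignTightFreeSpectral
open Summit.PneNP.PneNP.Theorems.ChebyshevTracialDesignTightLayerBimode
open Summit.PneNP.PneNP.Theorems.ChebyshevTracialDesignVirtualBimode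
open Summit.PneNP.PneNP.Theorems.ChebyshevTracialDesignVirtualNonnegSpread
open Summit.PneNP.PneNP.Theorems.ChebyshevTracialDesignDictionary
open Summit.PneNP.PneNP.Theorems.ChebyshevTracialDesignWeightedSNT

variable {n : ℕ}

/-- Unconditional form of `ChebyshevTracialDesignClassForcing.forcing_of_globalLevelD` (Keevash–Lifshitz Thm 1.8 discharged by `GlobalLevelDInequality_holds`).
[cite: KeevashLifshitz2023, Thm. 1.8] [cite: Rothvoss2017, §2 (PDF pp. 6–8)] -/
theorem forcing_holds {τ : ℝ} (hτ : 2 ≤ τ) :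
    ∃ c₀ : ℝ, 0 < c₀ ∧ ∃ n₁ : ℕ, ∀ (n t : ℕ), n₁ ≤ n → Even n → Odd t → n ≤ 5 * t → n ≤ 5 * (n - t) →
      ∀ (ε ν : ℝ), Real.exp (-(c₀ * dq n)) ≤ ε → Real.exp (-(c₀ * dq n)) ≤ ν →
      ∀ (r : ℕ), 0 < r → ∀ (X : OddSet n → Matrix (Fin r) (Fin r) ℝ) (Y : PMatch n → Matrix (Fin r) (Fin r) ℝ), IsPsdRect X Y →
      ∀ (H : Finset (PMatch n)),
      IsRelHomogeneousW τ (perfectMatchings (univ : Finset (Fin n)))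
        (fun M : Finset (Sym2 (Fin n)) => if hM : IsPMOn (univ : Finset (Fin n)) M then
          (if (⟨M, hM⟩ : PMatch n) ∈ H then (Y ⟨M, hM⟩).trace / r else 0) else 0)
        ((univ : Finset (PMatch n)).image Subtype.val) →
      ν * (Fintype.card (PMatch n) : ℝ) ≤ ∑ M ∈ H, (Y M).trace / r →
      ∀ (P : OddSet n → Prop) [DecidablePred P], (∀ M ∈ H, ∀ U, P U → X U * Y M ≠ 0) →
      ∑ U ∈ univ.filter (fun U : OddSet n => U.1.card = t ∧ P U), (X U).trace <
        ε * r * ((univ.filter fun U : OddSet n => U.1.card = t).card : ℝ) :=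
  Summit.PneNP.PneNP.Theorems.ChebyshevTracialDesignClassForcing.forcing_of_globalLevelD GlobalLevelDInequality_holds hτ

/-- Unconditional form of `ChebyshevTracialDesignDictionaryRemainder.tracialDecayExp_dictionaryRemainder_of_globalLevelD` (Keevash–Lifshitz Thm 1.8 discharged by `GlobalLevelDInequality_holds`).
[cite: KeevashLifshitz2023, Thm. 1.8] [cite: Rothvoss2017, §2 (PDF pp. 6–8)] -/
theorem tracialDecayExp_dictionaryRemainder_holds :
    ∃ a : ℝ, 0 < a ∧ ∃ n₁ : ℕ, ∀ n : ℕ, n₁ ≤ n → Even n → ∀ (t : ℕ) (C : Finset ℕ) (w : ℕ → ℝ),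
      IsBalancedDesign n t (Tq n) (dq n) 20 C w → ∀ (r : ℕ), 0 < r → ∀ (ι : Type) [Fintype ι],
        ∀ (v : ι → Fin r → ℝ), (∀ d, v d ⬝ᵥ v d ≤ 1) → ∀ (lam : OddSet n → ι → ℝ), (∀ U d, 0 ≤ lam U d ∧ lam U d ≤ 1) →
        ∀ (X D E : OddSet n → Matrix (Fin r) (Fin r) ℝ) (Y : PMatch n → Matrix (Fin r) (Fin r) ℝ), IsPsdRect X Y →
          (∀ U, X U = D U + E U) → (∀ U, D U = ∑ d, lam U d • vecMulVec (v d) (v d)) → (∀ U, (E U).PosSemidef) →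
            (∑ U, ∑ M, levelWeight n t C w U M * (X U * Y M).trace) / r ≤
              Fintype.card ι / r * Real.exp (-(a * (dq n : ℝ))) +
                20 * ((∑ U ∈ univ.filter (fun U : OddSet n => U.1.card = t), (E U).trace) /
                  ((r : ℝ) * (univ.filter (fun U : OddSet n => U.1.card = t)).card)) :=
  Summit.PneNP.PneNP.Theorems.ChebyshevTracialDesignDictionaryRemainder.tracialDecayExp_dictionaryRemainder_of_globalLevelD GlobalLevelDInequality_holds

/-- Unconditional form of `ChebyshevTracialDesignGeneralPositionKL.rankOne_traceDensity_lt_of_globalLevelD` (Keevash–Lifshitz Thm 1.8 discharged by `GlobalLevelDInequality_holds`).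
[cite: KeevashLifshitz2023, Thm. 1.8] [cite: Rothvoss2017, §2 (PDF pp. 6–8)] -/
theorem rankOne_traceDensity_lt_holds {τ : ℝ} (hτ : 1 ≤ τ) :
    ∃ c₀ : ℝ, 0 < c₀ ∧ ∃ n₁ : ℕ, ∀ (n t : ℕ), n₁ ≤ n → Even n → Odd t → n ≤ 5 * t → n ≤ 5 * (n - t) →
      ∀ (ε ν : ℝ), Real.exp (-(c₀ * dq n)) ≤ ε → Real.exp (-(c₀ * dq n)) ≤ ν →
      ∀ (r : ℕ), 0 < r → ∀ (X : OddSet n → Matrix (Fin r) (Fin r) ℝ) (Y : PMatch n → Matrix (Fin r) (Fin r) ℝ), IsPsdRect X Y →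
      ∀ (x : OddSet n → ℝ) (u : OddSet n → Fin r → ℝ), (∀ U, 0 ≤ x U ∧ x U ≤ 1) →
      (∀ U, X U = x U • vecMulVec (u U) (u U)) → (∀ U, 0 < x U → u U ⬝ᵥ u U = 1) → (∀ U, U.1.card ≠ t → X U = 0) →
      (∀ T : Finset (OddSet n), (∀ U ∈ T, 0 < x U) → T.card = r → LinearIndependent ℝ (fun U : T => u U.1)) →
      IsRelHomogeneousW τ (perfectMatchings (univ : Finset (Fin n)))
        (fun M : Finset (Sym2 (Fin n)) => if hM : IsPMOn (univ : Finset (Fin n)) M then (Y ⟨M, hM⟩).trace / r else 0)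
        ((univ : Finset (PMatch n)).image Subtype.val) →
      ν * (Fintype.card (PMatch n) : ℝ) ≤ ∑ M, (Y M).trace / r →
      (∑ U, (X U).trace) / r < 2 * (ε * ((univ.filter fun U : OddSet n => U.1.card = t).card : ℝ) + 1) :=
  Summit.PneNP.PneNP.Theorems.ChebyshevTracialDesignGeneralPositionKL.rankOne_traceDensity_lt_of_globalLevelD GlobalLevelDInequality_holds hτ

/-- Unconditional form of `ChebyshevTracialDesignGeneralPositionKL.third_of_matchings_piled_of_globalLevelD` (Keevash–Lifshitz Thm 1.8 discharged by `GlobalLevelDInequality_holds`).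
[cite: KeevashLifshitz2023, Thm. 1.8] [cite: Rothvoss2017, §2 (PDF pp. 6–8)] -/
theorem third_of_matchings_piled_holds {τ : ℝ} (hτ : 1 ≤ τ) :
    ∃ c₀ : ℝ, 0 < c₀ ∧ ∃ n₁ : ℕ, ∀ (n t : ℕ), n₁ ≤ n → Even n → Odd t → n ≤ 5 * t → n ≤ 5 * (n - t) →
      ∀ (ε ν : ℝ), Real.exp (-(c₀ * dq n)) ≤ ε → Real.exp (-(c₀ * dq n)) ≤ ν →
      ∀ (r : ℕ), 0 < r → ∀ (x : OddSet n → ℝ), (∀ U, 0 ≤ x U ∧ x U ≤ 1) → (∀ U, U.1.card ≠ t → x U = 0) →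
      ∀ (Y : PMatch n → Matrix (Fin r) (Fin r) ℝ), (∀ M, (Y M).PosSemidef ∧ (1 - Y M).PosSemidef) →
      IsRelHomogeneousW τ (perfectMatchings (univ : Finset (Fin n)))
        (fun M : Finset (Sym2 (Fin n)) => if hM : IsPMOn (univ : Finset (Fin n)) M then (Y ⟨M, hM⟩).trace / r else 0)
        ((univ : Finset (PMatch n)).image Subtype.val) →
      ν * (Fintype.card (PMatch n) : ℝ) ≤ ∑ M, (Y M).trace / r →
      ∀ (k : ℕ), 0 < k → ∀ (G : Fin k → Finset (OddSet n)),
      (∀ j, ε * ((univ.filter fun U : OddSet n => U.1.card = t).card : ℝ) ≤ ∑ U ∈ G j, x U) →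
      ∑ M, (Y M).trace < 3 * ∑ M ∈ univ.filter (fun M : PMatch n =>
        k < 4 * (univ.filter fun j : Fin k => ∃ U ∈ G j, 0 < x U ∧ cc U M = 1).card), (Y M).trace :=
  Summit.PneNP.PneNP.Theorems.ChebyshevTracialDesignGeneralPositionKL.third_of_matchings_piled_of_globalLevelD GlobalLevelDInequality_holds hτ

/-- Unconditional form of `ChebyshevTracialDesignProfileExtrapolationHalf.spreadCell_value_le_half_of_globalLevelD` (Keevash–Lifshitz Thm 1.8 discharged by `GlobalLevelDInequality_holds`).
[cite: KeevashLifshitz2023, Thm. 1.8] [cite: Rothvoss2017, §2 (PDF pp. 6–8)] -/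
theorem spreadCell_value_le_half_holds {τ : ℝ} (hτ : 1 ≤ τ) :
    ∃ c₀ : ℝ, 0 < c₀ ∧ c₀ ≤ 1 ∧ ∃ n₁ : ℕ, ∀ (n c' T D : ℕ) (Bv Γ : ℝ) (C : Finset ℕ) (w : ℕ → ℝ), n₁ ≤ n → Even n →
      2 * (2 * c' + 1) ≤ n → n ≤ 5 * (2 * c' + 1) → T ≤ 2 * c' + 1 → D + 2 ≤ 2 * c' → D ≤ 2 * (dq n + 8) →
      (∀ c ∈ C, Odd c ∧ 3 ≤ c ∧ c ≤ T ∧ (Qset n (2 * c' + 1) c).Nonempty) →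
      (∀ q : Polynomial ℝ, q.natDegree ≤ D → ∑ c ∈ C, w c * q.eval (c : ℝ) = -q.eval 0) →
      ∑ c ∈ C, |w c| ≤ Bv → 0 ≤ Γ →
      (∀ m : ℕ, 2 * m + 1 ≤ T →
        (1 + (2 * m * (2 * m + 1) : ℝ) / (4 * (c' - m + 1) * ((n / 2 - c' - m : ℕ) : ℝ))) ^ c' ≤ Γ) →
      ∀ (A : Finset (OddSet n)), (∀ U ∈ A, U.1.card = 2 * c' + 1) →
      ∀ (Y : Finset (PMatch n)), IsRelHomogeneous τ (perfectMatchings (univ : Finset (Fin n))) (Y.image Subtype.val) →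
      Real.exp (-(c₀ * dq n)) ≤ (A.card : ℝ) / (n.choose (2 * c' + 1) : ℝ) →
      Real.exp (-(c₀ * dq n)) ≤ (Y.card : ℝ) / (Fintype.card (PMatch n) : ℝ) →
        ∑ U ∈ A, ∑ M ∈ Y, levelWeight n (2 * c' + 1) C w U M ≤
          Bv * Γ * Real.sqrt ((∏ i ∈ range (D / 2 + 1), ((2 * i + 1 : ℝ) / ((n : ℝ) - 2 * i))) *
            ((A.card : ℝ) / (n.choose (2 * c' + 1) : ℝ)) * ((Y.card : ℝ) / (Fintype.card (PMatch n) : ℝ))) :=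
  Summit.PneNP.PneNP.Theorems.ChebyshevTracialDesignProfileExtrapolationHalf.spreadCell_value_le_half_of_globalLevelD GlobalLevelDInequality_holds hτ

/-- Unconditional form of `ChebyshevTracialDesignRectangleDecayAll.rectangleDecayAll_of_globalLevelD` (Keevash–Lifshitz Thm 1.8 discharged by `GlobalLevelDInequality_holds`).
[cite: KeevashLifshitz2023, Thm. 1.8] [cite: Rothvoss2017, §2 (PDF pp. 6–8)] -/
theorem rectangleDecayAll_holds :
    ∃ a : ℝ, 0 < a ∧ ∃ n₁ : ℕ, ∀ n : ℕ, n₁ ≤ n → Even n → ∀ (c' T Dg : ℕ) (Bv : ℝ) (C : Finset ℕ) (w : ℕ → ℝ),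
      IsExactDesign n (2 * c' + 1) T Dg Bv C w → n ≤ 4 * (2 * c' + 1) → T ≤ Tq n → dq n ≤ Dg + 2 → Dg ≤ dq n →
        ∀ (A : Finset (OddSet n)) (B : Finset (PMatch n)),
          ∑ U ∈ A, ∑ M ∈ B, levelWeight n (2 * c' + 1) C w U M ≤ Bv * Real.exp (-(a * (dq n : ℝ))) :=
  Summit.PneNP.PneNP.Theorems.ChebyshevTracialDesignRectangleDecayAll.rectangleDecayAll_of_globalLevelD GlobalLevelDInequality_holds

/-- Unconditional form of `ChebyshevTracialDesignReducedSpreadCell.reduced_spreadCell_value_le_of_globalLevelD` (Keevash–Lifshitz Thm 1.8 discharged by `GlobalLevelDInequality_holds`).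
[cite: KeevashLifshitz2023, Thm. 1.8] [cite: Rothvoss2017, §2 (PDF pp. 6–8)] -/
theorem reduced_spreadCell_value_le_holds :
    ∃ c₀ : ℝ, 0 < c₀ ∧ c₀ ≤ 1 ∧ ∃ n₀ : ℕ, ∀ (n q Dg T : ℕ) (Bv : ℝ) (C : Finset ℕ),
      (∀ c ∈ C, Odd c ∧ 3 ≤ c ∧ c ≤ T) → T * T ≤ 49 * n → 200 * T ≤ n → 40 * q ≤ n → 2 * q ≤ dq n → Dg ≤ dq n → 1 ≤ dq n →
      4 * dq n + 8 ≤ n →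
      ∀ (m t'' D' : ℕ) (w' : ℕ → ℝ), n₀ ≤ m → n ≤ m + 2 * q → Even m → Odd t'' → m ≤ 5 * t'' → m ≤ 5 * (m - t'') →
      T ≤ t'' → T ≤ m - t'' → D' + 3 ≤ t'' → D' + 3 ≤ m - t'' → Dg ≤ D' + q → D' ≤ Dg →
      (∀ c ∈ C, (Qset m t'' c).Nonempty) →
      (∀ p : Polynomial ℝ, p.natDegree ≤ D' → ∑ c ∈ C, w' c * p.eval (c : ℝ) = -p.eval 0) →
      ∑ c ∈ C, |w' c| ≤ Bv →
      ∀ (X : Finset (OddSet m)), (∀ U ∈ X, U.1.card = t'') →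
      ∀ (Y' : Finset (PMatch m)), IsRelHomogeneous (Real.exp 1) (perfectMatchings (univ : Finset (Fin m))) (Y'.image Subtype.val) →
      Real.exp (-(c₀ * dq m)) ≤ (X.card : ℝ) / (m.choose t'' : ℝ) →
      Real.exp (-(c₀ * dq m)) ≤ (Y'.card : ℝ) / (Fintype.card (PMatch m) : ℝ) →
      ∑ U ∈ X, ∑ M ∈ Y', levelWeight m t'' C w' U M ≤
        Bv * (Real.exp 2000 * Real.sqrt (∏ i ∈ range ((Dg - q) / 2 + 1), ((2 * i + 1 : ℝ) / ((n : ℝ) - 2 * q - 2 * i)))) :=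
  Summit.PneNP.PneNP.Theorems.ChebyshevTracialDesignReducedSpreadCell.reduced_spreadCell_value_le_of_globalLevelD GlobalLevelDInequality_holds

/-- Unconditional form of `ChebyshevTracialDesignSpectralNonTightness.snt_of_globalLevelD` (Keevash–Lifshitz Thm 1.8 discharged by `GlobalLevelDInequality_holds`).
[cite: KeevashLifshitz2023, Thm. 1.8] [cite: Rothvoss2017, §2 (PDF pp. 6–8)] -/
theorem snt_holds {τ : ℝ} (hτ : 1 ≤ τ) :
    ∃ c₀ : ℝ, 0 < c₀ ∧ ∃ n₁ : ℕ, ∀ (n c' : ℕ), n₁ ≤ n → Even n → 2 * (2 * c' + 1) ≤ n → n ≤ 4 * (2 * c' + 1) →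
      ∀ (X : Finset (Finset (Fin n))), X ⊆ univ.powersetCard (2 * c' + 1) →
      ∀ (Y : Finset (PMatch n)), IsRelHomogeneous τ (perfectMatchings (univ : Finset (Fin n))) (Y.image Subtype.val) →
      Real.exp (-(c₀ * dq n)) ≤ (X.card : ℝ) / (n.choose (2 * c' + 1) : ℝ) →
      Real.exp (-(c₀ * dq n)) ≤ (Y.card : ℝ) / (Fintype.card (PMatch n) : ℝ) →
      ∃ U ∈ X, ∃ M ∈ Y, (U.filter fun x => M.2.partner x ∉ U).card = 1 :=
  Summit.PneNP.PneNP.Theorems.ChebyshevTracialDesignSpectralNonTightness.snt_of_globalLevelD GlobalLevelDInequality_holds hτ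

/-- Unconditional form of `ChebyshevTracialDesignSpectralNonTightness.snt_oddSet_of_globalLevelD` (Keevash–Lifshitz Thm 1.8 discharged by `GlobalLevelDInequality_holds`).
[cite: KeevashLifshitz2023, Thm. 1.8] [cite: Rothvoss2017, §2 (PDF pp. 6–8)] -/
theorem snt_oddSet_holds {τ : ℝ} (hτ : 1 ≤ τ) :
    ∃ c₀ : ℝ, 0 < c₀ ∧ ∃ n₁ : ℕ, ∀ (n c' : ℕ), n₁ ≤ n → Even n → 2 * (2 * c' + 1) ≤ n → n ≤ 4 * (2 * c' + 1) →
      ∀ (X : Finset (OddSet n)), (∀ U ∈ X, U.1.card = 2 * c' + 1) →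
      ∀ (Y : Finset (PMatch n)), IsRelHomogeneous τ (perfectMatchings (univ : Finset (Fin n))) (Y.image Subtype.val) →
      Real.exp (-(c₀ * dq n)) ≤ (X.card : ℝ) / (n.choose (2 * c' + 1) : ℝ) →
      Real.exp (-(c₀ * dq n)) ≤ (Y.card : ℝ) / (Fintype.card (PMatch n) : ℝ) →
      ∃ U ∈ X, ∃ M ∈ Y, cc U M = 1 :=
  Summit.PneNP.PneNP.Theorems.ChebyshevTracialDesignSpectralNonTightness.snt_oddSet_of_globalLevelD GlobalLevelDInequality_holds hτ

/-- Unconditional form of `ChebyshevTracialDesignSpectralNonTightnessLayers.abs_layerCorr_even_le_KL` (Keevash–Lifshitz Thm 1.8 discharged by `GlobalLevelDInequality_holds`).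
[cite: KeevashLifshitz2023, Thm. 1.8] [cite: Rothvoss2017, §2 (PDF pp. 6–8)] -/
theorem abs_layerCorr_even_le_holds :
    ∃ C : ℝ, 0 < C ∧ ∀ (n c' κ : ℕ), Even n → 2 * (2 * c' + 1) ≤ n → 1 ≤ κ → κ ≤ c' →
      ∀ (Y : Finset (PMatch n)) (τ : ℝ), 1 ≤ τ →
      IsRelHomogeneous τ (perfectMatchings (univ : Finset (Fin n))) (Y.image Subtype.val) →
      ((2 * κ : ℕ) : ℝ) ≤ Real.log (1 / ((Y.card : ℝ) / Fintype.card (PMatch n))) / 8 →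
      ((2 * κ : ℕ) : ℝ) ≤ (n : ℝ) / 10 ^ 5 →
      ∀ (p : ℕ → Finset (Fin n) → ℝ), (∀ j, IsHarmonic j (p j)) → ∀ (κ₁ : ℕ → ℝ),
      (∀ U ∈ univ.powersetCard (2 * c' + 1), ∀ U' ∈ univ.powersetCard (2 * c' + 1),
        ∑ M : PMatch n, (if (U.filter fun x => M.2.partner x ∉ U).card = 1 then (1 : ℝ) else 0) *
          (if (U'.filter fun x => M.2.partner x ∉ U').card = 1 then (1 : ℝ) else 0) = κ₁ (U ∩ U').card) →
      |∑ M ∈ Y, ∑ U ∈ univ.powersetCard (2 * c' + 1),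
          (up^[2 * c' + 1 - 2 * κ] (p (2 * κ))) U * (if (U.filter fun x => M.2.partner x ∉ U).card = 1 then (1 : ℝ) else 0)| ≤
        (Fintype.card (PMatch n) : ℝ) * ((((n / 2).choose (1 + c') * (1 + c').choose c' * 2 ^ 1 : ℕ) : ℝ)) *
          (((Y.card : ℝ) / Fintype.card (PMatch n)) *
            (C * τ ^ 2 * (1 / ((2 * κ : ℕ) : ℝ)) * Real.log (1 / ((Y.card : ℝ) / Fintype.card (PMatch n)))) ^ κ *
            Real.sqrt ((∏ i ∈ range κ, ((2 * i + 1 : ℝ) / ((n : ℝ) - 2 * i))) *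
              (ip (up^[2 * c' + 1 - 2 * κ] (p (2 * κ))) (up^[2 * c' + 1 - 2 * κ] (p (2 * κ))) / (n.choose (2 * c' + 1) : ℝ)))) :=
  Summit.PneNP.PneNP.Theorems.ChebyshevTracialDesignSpectralNonTightnessLayers.abs_layerCorr_even_le_KL GlobalLevelDInequality_holds

/-- Unconditional form of `ChebyshevTracialDesignSpectralNonTightnessWide.snt_wide_of_globalLevelD` (Keevash–Lifshitz Thm 1.8 discharged by `GlobalLevelDInequality_holds`).
[cite: KeevashLifshitz2023, Thm. 1.8] [cite: Rothvoss2017, §2 (PDF pp. 6–8)] -/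
theorem snt_wide_holds {τ : ℝ} (hτ : 1 ≤ τ) :
    ∃ c₀ : ℝ, 0 < c₀ ∧ ∃ n₁ : ℕ, ∀ (n c' : ℕ), n₁ ≤ n → Even n → 2 * (2 * c' + 1) ≤ n → n ≤ 5 * (2 * c' + 1) →
      ∀ (X : Finset (Finset (Fin n))), X ⊆ univ.powersetCard (2 * c' + 1) →
      ∀ (Y : Finset (PMatch n)), IsRelHomogeneous τ (perfectMatchings (univ : Finset (Fin n))) (Y.image Subtype.val) →
      Real.exp (-(c₀ * dq n)) ≤ (X.card : ℝ) / (n.choose (2 * c' + 1) : ℝ) →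
      Real.exp (-(c₀ * dq n)) ≤ (Y.card : ℝ) / (Fintype.card (PMatch n) : ℝ) →
      ∃ U ∈ X, ∃ M ∈ Y, (U.filter fun x => M.2.partner x ∉ U).card = 1 :=
  Summit.PneNP.PneNP.Theorems.ChebyshevTracialDesignSpectralNonTightnessWide.snt_wide_of_globalLevelD GlobalLevelDInequality_holds hτ

/-- Unconditional form of `ChebyshevTracialDesignTightMass.tight_card_ge_wide_of_globalLevelD` (Keevash–Lifshitz Thm 1.8 discharged by `GlobalLevelDInequality_holds`).
[cite: KeevashLifshitz2023, Thm. 1.8] [cite: Rothvoss2017, §2 (PDF pp. 6–8)] -/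
theorem tight_card_ge_wide_holds {τ : ℝ} (hτ : 1 ≤ τ) :
    ∃ c₀ : ℝ, 0 < c₀ ∧ ∃ n₁ : ℕ, ∀ (n c' : ℕ), n₁ ≤ n → Even n → 2 * (2 * c' + 1) ≤ n → n ≤ 5 * (2 * c' + 1) →
      ∀ (X : Finset (Finset (Fin n))), X ⊆ univ.powersetCard (2 * c' + 1) →
      ∀ (Y : Finset (PMatch n)), IsRelHomogeneous τ (perfectMatchings (univ : Finset (Fin n))) (Y.image Subtype.val) →
      Real.exp (-(c₀ * dq n)) ≤ (X.card : ℝ) / (n.choose (2 * c' + 1) : ℝ) →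
      Real.exp (-(c₀ * dq n)) ≤ (Y.card : ℝ) / (Fintype.card (PMatch n) : ℝ) →
      (29 / 60 : ℝ) * ((X.card : ℝ) / (n.choose (2 * c' + 1) : ℝ)) * ((Y.card : ℝ) / (Fintype.card (PMatch n) : ℝ)) *
          ((Fintype.card (PMatch n) : ℝ) * ((((n / 2).choose (1 + c') * (1 + c').choose c' * 2 ^ 1 : ℕ) : ℝ))) ≤
        ((((X ×ˢ Y).filter fun UM : Finset (Fin n) × PMatch n =>
          (UM.1.filter fun x => UM.2.2.partner x ∉ UM.1).card = 1).card : ℕ) : ℝ) :=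
  Summit.PneNP.PneNP.Theorems.ChebyshevTracialDesignTightMass.tight_card_ge_wide_of_globalLevelD GlobalLevelDInequality_holds hτ

/-- Unconditional form of `ChebyshevTracialDesignTightMass.tight_card_ge_sym_oddSet_of_globalLevelD` (Keevash–Lifshitz Thm 1.8 discharged by `GlobalLevelDInequality_holds`).
[cite: KeevashLifshitz2023, Thm. 1.8] [cite: Rothvoss2017, §2 (PDF pp. 6–8)] -/
theorem tight_card_ge_sym_oddSet_holds {τ : ℝ} (hτ : 1 ≤ τ) :
    ∃ c₀ : ℝ, 0 < c₀ ∧ ∃ n₁ : ℕ, ∀ (n t : ℕ), n₁ ≤ n → Even n → Odd t → n ≤ 5 * t → n ≤ 5 * (n - t) →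
      ∀ (X : Finset (OddSet n)), (∀ U ∈ X, U.1.card = t) →
      ∀ (Y : Finset (PMatch n)), IsRelHomogeneous τ (perfectMatchings (univ : Finset (Fin n))) (Y.image Subtype.val) →
      Real.exp (-(c₀ * dq n)) ≤ (X.card : ℝ) / (n.choose t : ℝ) →
      Real.exp (-(c₀ * dq n)) ≤ (Y.card : ℝ) / (Fintype.card (PMatch n) : ℝ) →
      (29 / 60 : ℝ) * ((X.card : ℝ) / (n.choose t : ℝ)) * ((Y.card : ℝ) / (Fintype.card (PMatch n) : ℝ)) * ((Qset n t 1).card : ℝ) ≤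
        ((((X ×ˢ Y).filter fun UM : OddSet n × PMatch n => cc UM.1 UM.2 = 1).card : ℕ) : ℝ) :=
  Summit.PneNP.PneNP.Theorems.ChebyshevTracialDesignTightMass.tight_card_ge_sym_oddSet_of_globalLevelD GlobalLevelDInequality_holds hτ

/-- Unconditional form of `ChebyshevTracialDesignVirtualNonnegSpread.head_layerBound_of_globalLevelD` (Keevash–Lifshitz Thm 1.8 discharged by `GlobalLevelDInequality_holds`).
[cite: KeevashLifshitz2023, Thm. 1.8] [cite: Rothvoss2017, §2 (PDF pp. 6–8)] -/
theorem head_layerBound_holds {τ : ℝ} (hτ : 1 ≤ τ) :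
    ∃ c₀ : ℝ, 0 < c₀ ∧ c₀ ≤ 1 ∧ ∃ n₁ : ℕ, ∀ (n c' : ℕ), n₁ ≤ n → Even n → 2 * (2 * c' + 1) ≤ n → n ≤ 5 * (2 * c' + 1) →
      ∀ (X : Finset (Finset (Fin n))), X ⊆ univ.powersetCard (2 * c' + 1) →
      ∀ (p : ℕ → Finset (Fin n) → ℝ), (∀ j, IsHarmonic j (p j)) →
        (∀ U ∈ univ.powersetCard (2 * c' + 1),
          (if U ∈ X then (1 : ℝ) else 0) = (∑ j ∈ range (2 * c' + 1 + 1), up^[2 * c' + 1 - j] (p j)) U) →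
      ∀ (Y : Finset (PMatch n)), IsRelHomogeneous τ (perfectMatchings (univ : Finset (Fin n))) (Y.image Subtype.val) →
      Real.exp (-(c₀ * dq n)) ≤ (X.card : ℝ) / (n.choose (2 * c' + 1) : ℝ) →
      Real.exp (-(c₀ * dq n)) ≤ (Y.card : ℝ) / (Fintype.card (PMatch n) : ℝ) →
      ∀ κ : ℕ, 1 ≤ κ → κ ≤ c' → κ ≤ dq n + 8 →
        |∑ M ∈ Y, ∑ U ∈ univ.powersetCard (2 * c' + 1),
            (up^[2 * c' + 1 - 2 * κ] (p (2 * κ))) U * (if (U.filter fun x => M.2.partner x ∉ U).card = 1 then (1 : ℝ) else 0)| /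
            ((Fintype.card (PMatch n) : ℝ) * ((((n / 2).choose (1 + c') * (1 + c').choose c' * 2 ^ 1 : ℕ) : ℝ))) ≤
          4 * ((X.card : ℝ) / (n.choose (2 * c' + 1) : ℝ)) * ((Y.card : ℝ) / (Fintype.card (PMatch n) : ℝ)) * (1 / 16) ^ κ :=
  Summit.PneNP.PneNP.Theorems.ChebyshevTracialDesignVirtualNonnegSpread.head_layerBound_of_globalLevelD GlobalLevelDInequality_holds hτ

/-- Unconditional form of `ChebyshevTracialDesignVirtualNonnegSpread.virtual_nonneg_spread_of_globalLevelD` (Keevash–Lifshitz Thm 1.8 discharged by `GlobalLevelDInequality_holds`).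
[cite: KeevashLifshitz2023, Thm. 1.8] [cite: Rothvoss2017, §2 (PDF pp. 6–8)] -/
theorem virtual_nonneg_spread_holds {τ : ℝ} (hτ : 1 ≤ τ) :
    ∃ c₀ : ℝ, 0 < c₀ ∧ c₀ ≤ 1 ∧ ∃ n₁ : ℕ, ∀ (n c' D : ℕ), n₁ ≤ n → Even n → 2 * (2 * c' + 1) ≤ n → n ≤ 5 * (2 * c' + 1) →
      D + 2 ≤ 2 * c' → D ≤ 2 * (dq n + 8) →
      ∀ (X : Finset (Finset (Fin n))), X ⊆ univ.powersetCard (2 * c' + 1) →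
      ∀ (p : ℕ → Finset (Fin n) → ℝ), (∀ j, IsHarmonic j (p j)) →
        (∀ U ∈ univ.powersetCard (2 * c' + 1),
          (if U ∈ X then (1 : ℝ) else 0) = (∑ j ∈ range (2 * c' + 1 + 1), up^[2 * c' + 1 - j] (p j)) U) →
      ∀ (Y : Finset (PMatch n)), IsRelHomogeneous τ (perfectMatchings (univ : Finset (Fin n))) (Y.image Subtype.val) →
      Real.exp (-(c₀ * dq n)) ≤ (X.card : ℝ) / (n.choose (2 * c' + 1) : ℝ) →
      Real.exp (-(c₀ * dq n)) ≤ (Y.card : ℝ) / (Fintype.card (PMatch n) : ℝ) →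
        (3 / 7 : ℝ) * (((X.card : ℝ) / (n.choose (2 * c' + 1) : ℝ)) * ((Y.card : ℝ) / (Fintype.card (PMatch n) : ℝ))) ≤
          (Fintype.card (PMatch n) : ℝ)⁻¹ * ∑ M ∈ Y, ∑ A : {A : Finset (Fin n) // A.card ≤ D},
            (∑ j ∈ range (2 * c' + 1 + 1), ((2 * c' + 1 - j).factorial : ℝ) • (if D < j then 0 else p j)) A.1 *
              knapsackMoment M.1.card (((2 * c' + 1 : ℕ) : ℝ) / 2) (M.1.filter fun e => ∃ a ∈ A.1, a ∈ e).card :=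
  Summit.PneNP.PneNP.Theorems.ChebyshevTracialDesignVirtualNonnegSpread.virtual_nonneg_spread_of_globalLevelD GlobalLevelDInequality_holds hτ

/-- Unconditional form of `ChebyshevTracialDesignVirtualNonnegSpread.spreadCell_value_le_of_globalLevelD` (Keevash–Lifshitz Thm 1.8 discharged by `GlobalLevelDInequality_holds`).
[cite: KeevashLifshitz2023, Thm. 1.8] [cite: Rothvoss2017, §2 (PDF pp. 6–8)] -/
theorem spreadCell_value_le_holds {τ : ℝ} (hτ : 1 ≤ τ) :
    ∃ c₀ : ℝ, 0 < c₀ ∧ c₀ ≤ 1 ∧ ∃ n₁ : ℕ, ∀ (n c' T D : ℕ) (Bv : ℝ) (C : Finset ℕ) (w : ℕ → ℝ), n₁ ≤ n → Even n →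
      IsExactDesign n (2 * c' + 1) T D Bv C w → n ≤ 5 * (2 * c' + 1) → D + 2 ≤ 2 * c' → D ≤ 2 * (dq n + 8) →
      ∀ (A : Finset (OddSet n)), (∀ U ∈ A, U.1.card = 2 * c' + 1) →
      ∀ (Y : Finset (PMatch n)), IsRelHomogeneous τ (perfectMatchings (univ : Finset (Fin n))) (Y.image Subtype.val) →
      Real.exp (-(c₀ * dq n)) ≤ (A.card : ℝ) / (n.choose (2 * c' + 1) : ℝ) →
      Real.exp (-(c₀ * dq n)) ≤ (Y.card : ℝ) / (Fintype.card (PMatch n) : ℝ) →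
        ∑ U ∈ A, ∑ M ∈ Y, levelWeight n (2 * c' + 1) C w U M ≤
          Bv * Real.sqrt ((∏ i ∈ range (D / 2 + 1), ((2 * i + 1 : ℝ) / ((n : ℝ) - 2 * i))) *
            ((A.card : ℝ) / (n.choose (2 * c' + 1) : ℝ)) * ((Y.card : ℝ) / (Fintype.card (PMatch n) : ℝ))) :=
  Summit.PneNP.PneNP.Theorems.ChebyshevTracialDesignVirtualNonnegSpread.spreadCell_value_le_of_globalLevelD GlobalLevelDInequality_holds hτ

/-- Unconditional form of `ChebyshevTracialDesignWeightedSNT.weightedSNT_subweights_of_globalLevelD` (Keevash–Lifshitz Thm 1.8 discharged by `GlobalLevelDInequality_holds`).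
[cite: KeevashLifshitz2023, Thm. 1.8] [cite: Rothvoss2017, §2 (PDF pp. 6–8)] -/
theorem weightedSNT_subweights_holds {τ : ℝ} (hτ : 1 ≤ τ) :
    ∃ c₀ : ℝ, 0 < c₀ ∧ ∃ n₁ : ℕ, ∀ (n t : ℕ), n₁ ≤ n → Even n → Odd t → n ≤ 5 * t → n ≤ 5 * (n - t) →
      ∀ (ε ν : ℝ), Real.exp (-(c₀ * dq n)) ≤ ε → Real.exp (-(c₀ * dq n)) ≤ ν →
      ∀ (x : OddSet n → ℝ) (z : PMatch n → ℝ), (∀ U, 0 ≤ x U ∧ x U ≤ 1) → (∀ U, U.1.card ≠ t → x U = 0) →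
      (∀ M, 0 ≤ z M ∧ z M ≤ 1) →
      IsRelHomogeneousW τ (perfectMatchings (univ : Finset (Fin n)))
        (fun M : Finset (Sym2 (Fin n)) => if hM : IsPMOn (univ : Finset (Fin n)) M then z ⟨M, hM⟩ else 0)
        ((univ : Finset (PMatch n)).image Subtype.val) →
      ν * (Fintype.card (PMatch n) : ℝ) ≤ ∑ M, z M →
      ∀ x' : OddSet n → ℝ, (∀ U, 0 ≤ x' U ∧ x' U ≤ x U) →
        ε * ((univ.filter fun U : OddSet n => U.1.card = t).card : ℝ) ≤ ∑ U, x' U →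
      ∀ z' : PMatch n → ℝ, (∀ M, 0 ≤ z' M ∧ z' M ≤ z M) → ∑ M, z M ≤ 2 * ∑ M, z' M →
        ∃ U M, cc U M = 1 ∧ 0 < x' U ∧ 0 < z' M :=
  Summit.PneNP.PneNP.Theorems.ChebyshevTracialDesignWeightedSNT.weightedSNT_subweights_of_globalLevelD GlobalLevelDInequality_holds hτ

end Summit.PneNP.PneNP.Theorems.ChebyshevTracialDesignUnconditionalRungs
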